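import Summits.ValiantsHypothesis.ValiantsHypothesis.Theorems.LacunarySymmetroidMatrixDescartesDoorA26WallBubblingPureDSieve

/-!
# Wall bubbling for `DoorA26` — (W) second rung: THE FIRST-ORDER SIEVE PASSES AT WEYL FACES (every Weyl pattern is realisable)

HONEST FRAMING.  Rung file for obligation (W) `stub_weylFaces` of `Cruxes/DoorA26/Lines/wall_bubbling.lean` (stmt-ValiantsHypothesis-19979
`DoorA26`; OPEN, typed, never asserted), re-pointed seat val-sym-door-p1 g13 (W2).  Companion of `…WallBubblingWeylAnatomy` (which shows what a
REALISED first-order Weyl pattern forces on the letters).  Here the converse bookkeeping: EVERY first-order Weyl pattern — a symmetric `6 × 6`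
matrix supported on the rows/columns `i, j` with `G i k = −G j k` (`k ∉ {i,j}`) and `G i i + 2 G i j + G j j = 0` — IS realisable by explicit
real symmetric `2 × 2` letters lying on the stratum `Σ_W` (`weylPattern_realisable`), and its quadratic form is the product of the two linear
forms `x_i − x_j` and `a x_i − c x_j + 2 Σ_k g_k x_k` (`weylPattern_quadForm_factor`).  So the first-order sieve of the line PASSES at every
Weyl face — (W) is genuinely a second-order statement (the card recorded this as a random-search located fact; here it is a theorem).  No new
definitions (`Realisable` inlined as in p610269); nothing here bears on `DoorA26`, `MatrixDescartes` (stmt-ValiantsHypothesis-18050) or `VP ≠ VNP`.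

[folklore] Explicit `2 × 2` letters; elementary algebra.
-/

-- `Summit.ValiantsHypothesis.ValiantsHypothesis.…` repeats a component by the D-0017 layout
-- (single-conjunct summit), which the `dupNamespace` linter flags; the name is mandated.
set_option linter.dupNamespace false

namespace Summit.ValiantsHypothesis.ValiantsHypothesis.Theorems.LacunarySymmetroidMatrixDescartes.WallBubbling

open Finset Matrix
open scoped BigOperators

/-- The quadratic form of a first-order Weyl pattern FACTORS: `xᵀ G x = (x i − x j)·(a x i − c x j + 2 Σ_{k ∉ {i,j}} g k x k)`.
In particular `G` has rank `≤ 2` and is never definite on a `2`-plane. [folklore] -/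
theorem weylPattern_quadForm_factor (i j : Fin 6) (hij : i ≠ j) (a b c : ℝ) (g : Fin 6 → ℝ) (habc : a + 2 * b + c = 0)
    (G : Matrix (Fin 6) (Fin 6) ℝ) (hGii : G i i = a) (hGij : G i j = b) (hGji : G j i = b) (hGjj : G j j = c)
    (hGik : ∀ k, k ≠ i → k ≠ j → G i k = g k ∧ G k i = g k)
    (hGjk : ∀ k, k ≠ i → k ≠ j → G j k = -g k ∧ G k j = -g k)
    (hG0 : ∀ k l, k ≠ i → k ≠ j → l ≠ i → l ≠ j → G k l = 0) (x : Fin 6 → ℝ) :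
    ∑ p, ∑ q, x p * G p q * x q
      = (x i - x j) * (a * x i - c * x j + 2 * ∑ k ∈ (Finset.univ.erase i).erase j, g k * x k) := by
  classical
  -- split every sum into the `i`-term, the `j`-term and the rest
  have hjmem : j ∈ Finset.univ.erase i := Finset.mem_erase.mpr ⟨hij.symm, Finset.mem_univ _⟩
  have split : ∀ f : Fin 6 → ℝ, ∑ p, f p = f i + f j + ∑ k ∈ (Finset.univ.erase i).erase j, f k := by
    intro f
    rw [← Finset.add_sum_erase _ _ (Finset.mem_univ i), ← Finset.add_sum_erase _ _ hjmem, add_assoc]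
  have hrest : ∀ k ∈ (Finset.univ.erase i).erase j, k ≠ i ∧ k ≠ j := by
    intro k hk
    simp only [Finset.mem_erase, Finset.mem_univ, and_true] at hk
    exact ⟨hk.2, hk.1⟩
  -- inner sums
  have inner : ∀ p, ∑ q, x p * G p q * x q
      = x p * G p i * x i + x p * G p j * x j + ∑ k ∈ (Finset.univ.erase i).erase j, x p * G p k * x k :=
    fun p => split _
  simp_rw [inner]
  rw [split]
  -- the rest-rows: `G k q` vanishes except at `q = i, j`
  have hrows : ∑ k ∈ (Finset.univ.erase i).erase j,
      (x k * G k i * x i + x k * G k j * x j + ∑ l ∈ (Finset.univ.erase i).erase j, x k * G k l * x l)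
      = ∑ k ∈ (Finset.univ.erase i).erase j, (x k * g k * x i - x k * g k * x j) := by
    refine Finset.sum_congr rfl fun k hk => ?_
    obtain ⟨hki, hkj⟩ := hrest k hk
    rw [(hGik k hki hkj).2, (hGjk k hki hkj).2]
    rw [Finset.sum_eq_zero (fun l hl => by
      obtain ⟨hli, hlj⟩ := hrest l hl
      rw [hG0 k l hki hkj hli hlj]; ring)]
    ring
  have hrowi : ∑ k ∈ (Finset.univ.erase i).erase j, x i * G i k * x k
      = x i * ∑ k ∈ (Finset.univ.erase i).erase j, g k * x k := by
    rw [Finset.mul_sum]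
    refine Finset.sum_congr rfl fun k hk => ?_
    obtain ⟨hki, hkj⟩ := hrest k hk
    rw [(hGik k hki hkj).1]; ring
  have hrowj : ∑ k ∈ (Finset.univ.erase i).erase j, x j * G j k * x k
      = -(x j * ∑ k ∈ (Finset.univ.erase i).erase j, g k * x k) := by
    rw [Finset.mul_sum, ← Finset.sum_neg_distrib]
    refine Finset.sum_congr rfl fun k hk => ?_
    obtain ⟨hki, hkj⟩ := hrest k hk
    rw [(hGjk k hki hkj).1]; ring
  have hrows' : ∑ k ∈ (Finset.univ.erase i).erase j, (x k * g k * x i - x k * g k * x j)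
      = (x i - x j) * ∑ k ∈ (Finset.univ.erase i).erase j, g k * x k := by
    rw [Finset.mul_sum]
    exact Finset.sum_congr rfl fun k _ => by ring
  rw [hrows, hrowi, hrowj, hrows', hGii, hGij, hGji, hGjj]
  have hc : c = -a - 2 * b := by linarith
  rw [hc]
  ring

/-- **THE FIRST-ORDER SIEVE PASSES AT WEYL FACES.**  Every first-order Weyl pattern at the pair `{i, j}` (`a + 2b + c = 0`) is realisable:
`G p q = ε·polar(S p, S q)` for `ε = 1` and explicit symmetric letters on the stratum `Σ_W` — `S k = g k·E₁₁` (`k ∉ {i,j}`),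
`S i = [[a, 0],[0, 1]]`, `S j = [[−c, 0],[0, −1]]`, `S k = [[2 g k, 0],[0, 0]]`, so that `S i + S j = [[a − c, 0],[0, 0]] ∈ ℝ·E₁₁`. [folklore] -/
theorem weylPattern_realisable (i j : Fin 6) (hij : i ≠ j) (a b c : ℝ) (g : Fin 6 → ℝ) (habc : a + 2 * b + c = 0)
    (G : Matrix (Fin 6) (Fin 6) ℝ) (hGii : G i i = a) (hGij : G i j = b) (hGji : G j i = b) (hGjj : G j j = c)
    (hGik : ∀ k, k ≠ i → k ≠ j → G i k = g k ∧ G k i = g k)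
    (hGjk : ∀ k, k ≠ i → k ≠ j → G j k = -g k ∧ G k j = -g k)
    (hG0 : ∀ k l, k ≠ i → k ≠ j → l ≠ i → l ≠ j → G k l = 0) :
    ∃ (ε : ℝ) (S : Fin 6 → Matrix (Fin 2) (Fin 2) ℝ), (ε = 1 ∨ ε = -1) ∧ (∀ l, (S l).IsSymm) ∧
      ∀ p q, G p q = ε * (((S p + S q).det - (S p).det - (S q).det) / 2) := by
  classical
  -- the letters
  let S : Fin 6 → Matrix (Fin 2) (Fin 2) ℝ := fun k =>
    if k = i then !![a, 0; 0, 1] else if k = j then !![-c, 0; 0, -1] else !![2 * g k, 0; 0, 0]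
  have hSi : S i = !![a, 0; 0, 1] := by simp [S]
  have hSj : S j = !![-c, 0; 0, -1] := by simp [S, hij.symm]
  have hSk : ∀ k, k ≠ i → k ≠ j → S k = !![2 * g k, 0; 0, 0] := fun k hki hkj => by simp [S, hki, hkj]
  refine ⟨1, S, Or.inl rfl, ?_, ?_⟩
  · intro l
    by_cases hli : l = i
    · subst hli; rw [hSi]; exact Matrix.IsSymm.ext (by intro p q; fin_cases p <;> fin_cases q <;> rfl)
    by_cases hlj : l = j
    · subst hlj; rw [hSj]; exact Matrix.IsSymm.ext (by intro p q; fin_cases p <;> fin_cases q <;> rfl)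
    · rw [hSk l hli hlj]; exact Matrix.IsSymm.ext (by intro p q; fin_cases p <;> fin_cases q <;> rfl)
  · -- entry by entry, by cases on whether `p, q ∈ {i, j}`
    have hpol : ∀ (P Q : Matrix (Fin 2) (Fin 2) ℝ),
        ((P + Q).det - P.det - Q.det) / 2 = (P 0 0 * Q 1 1 + Q 0 0 * P 1 1 - P 0 1 * Q 1 0 - Q 0 1 * P 1 0) / 2 :=
      fun P Q => polar_entries P Q
    intro p q
    rw [one_mul, hpol]
    by_cases hpi : p = i
    · rw [hpi]
      by_cases hqi : q = i
      · rw [hqi, hGii, hSi]; simp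
      by_cases hqj : q = j
      · rw [hqj, hGij, hSi, hSj]; simp; linarith
      · rw [(hGik q hqi hqj).1, hSi, hSk q hqi hqj]; simp
    by_cases hpj : p = j
    · rw [hpj]
      by_cases hqi : q = i
      · rw [hqi, hGji, hSi, hSj]; simp; linarith
      by_cases hqj : q = j
      · rw [hqj, hGjj, hSj]; simp
      · rw [(hGjk q hqi hqj).1, hSj, hSk q hqi hqj]; simp; ring
    · by_cases hqi : q = i
      · rw [hqi, (hGik p hpi hpj).2, hSi, hSk p hpi hpj]; simp
      by_cases hqj : q = j
      · rw [hqj, (hGjk p hpi hpj).2, hSj, hSk p hpi hpj]; simp; ring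
      · rw [hG0 p q hpi hpj hqi hqj, hSk p hpi hpj, hSk q hqi hqj]; simp

end Summit.ValiantsHypothesis.ValiantsHypothesis.Theorems.LacunarySymmetroidMatrixDescartes.WallBubbling
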